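import Mathlib
import Summits.ValiantsHypothesis.ValiantsHypothesis.Theorems.ProofCarryingSymmetryRestorationQPPCLayoutSteps

/-!
# Route ProofCarryingSymmetry — crux `RestorationQP`, line `registered`: the gate line of an internal gate of fan-in at least two

Necessity of the provability stub T′ (`stub_invarianceProvableQP'`), part 4b.  With the gate-line
macros of part 4a: `gateLine_of_comb` — the gate line `Fρ_{out g} = F_{out (π g)}` of an internal
gate `g` of fan-in `r ≥ 2` from the gate lines of its children: unshare both combs (Step A), replace
the children of `g` by their images (the children's lines, pointwise congruence), sort the comb by
the permutation relating the two enumerations of `children (π g) = π (children g)` (a SET equality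
— `toList_map_perm`), re-share; cost `≤ 60·M·(|G|+2)³`.  Everything proved, no named facts.
-/

-- single-problem summit: `Summit.ValiantsHypothesis.ValiantsHypothesis.…` is the namespace by design (D-0017)
set_option linter.dupNamespace false

noncomputable section

open scoped Classical

namespace Summit.ValiantsHypothesis.ValiantsHypothesis.Theorems

namespace PCR

open Literature.Computability.AlgebraicComplexity PICircuit ACStability

universe u v

variable {𝔽 : Type u} [CommRing 𝔽] {X : Type v} {Yo : Type*} {G : Type*} [Fintype G]
variable {D : LabelledArithCircuit 𝔽 X Yo G} {f : G → ℕ} {P : ℕ} {ρ : X → X} {π : Equiv.Perm G}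

/-! ### Bookkeeping -/

/-- Weight of a comb of prefixes of one body. [folklore] -/
theorem W_pre_le {B' : List (Node 𝔽 X)} {ι : Type*} (a : ℕ) (l : List ι) (idx : ι → ℕ) {s M : ℕ}
    (hl : l.length + 1 ≤ s) (hM : s * (B'.length + 2) ≤ M) :
    W (pcSystem 𝔽 X) (pre B' a) (l.map fun c => pre B' (idx c)) ≤ M := by
  have h1 := W_le_of_forall (S := pcSystem 𝔽 X) (a := pre B' a) (l := l.map fun c => pre B' (idx c))
    (b := B'.length + 1) (size_pre_le B' a) (fun x hx => by
      obtain ⟨c, -, rfl⟩ := List.mem_map.1 hx; exact size_pre_le B' _)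
  rw [List.length_map] at h1
  have h2 : B'.length + 1 + l.length * (B'.length + 1 + 1) ≤ s * (B'.length + 2) := by nlinarith
  omega

/-- Cost bookkeeping of the comb case. [folklore] -/
theorem arith_comb (M r s : ℕ) (hr : r ≤ s) :
    16 * M * (r - 1) + 16 * M * (r - 1) + 2 * M * (r - 1) + 50 * M * (r - 1 + 2) ^ 3 + 2 * M + 6 * M ≤
      60 * M * (s + 2) ^ 3 := by
  have h1 : r - 1 ≤ s := by omega
  have h2 : (r - 1 + 2) ^ 3 ≤ (s + 2) ^ 3 := Nat.pow_le_pow_left (by omega) 3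
  have h4 : 4 * (s + 2) ≤ (s + 2) ^ 3 := by
    have : 4 ≤ (s + 2) ^ 2 := by nlinarith
    calc 4 * (s + 2) ≤ (s + 2) ^ 2 * (s + 2) := Nat.mul_le_mul_right _ this
      _ = (s + 2) ^ 3 := by ring
  have h3 : 34 * (r - 1) + 8 ≤ 10 * (s + 2) ^ 3 := by linarith
  have key : 16 * (r - 1) + 16 * (r - 1) + 2 * (r - 1) + 50 * (r - 1 + 2) ^ 3 + 2 + 6 ≤ 60 * (s + 2) ^ 3 := by
    nlinarith
  have := Nat.mul_le_mul_left M key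
  nlinarith [this]

/-! ### The comb case -/

/-- **Gate line of an internal gate of fan-in at least two.** [folklore] -/
theorem gateLine_of_comb {L : List (PICircuit 𝔽 X × PICircuit 𝔽 X)} {n : ℕ} (h : Real (pcSystem 𝔽 X) L n)
    (hmono : ∀ g h : G, h ∈ D.children g → f h < f g)
    (Kt : OpKit (pcSystem 𝔽 X)) (mk : ℕ → ℕ → Node 𝔽 X) (hmk : ∀ a b, (mk a b).rename ρ = mk a b)
    (hun : ∀ {L' : List (PICircuit 𝔽 X × PICircuit 𝔽 X)} {n' i a b M' : ℕ} {B' : List (Node 𝔽 X)},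
      Real (pcSystem 𝔽 X) L' n' → B'.getD i (.const 0) = mk a b → a < i → b < i → B'.length + 1 ≤ M' →
      Real (pcSystem 𝔽 X) ((pre B' i, Kt.op (pre B' a) (pre B' b)) :: L') (n' + 4 * M'))
    {g : G}
    (hfirstL : ∀ g' : G, D.label g' = D.label g → 2 ≤ (D.children g').toList.length →
      (layoutBody D f P).getD (f g' * bl (G := G) + (bl (G := G) + 1 - (D.children g').toList.length)) (.const 0) =
        mk ((kidPos D f g').getD 0 0) ((kidPos D f g').getD 1 0))
    (hsuccL : ∀ g' : G, D.label g' = D.label g → ∀ k, 2 ≤ k → k < (D.children g').toList.length →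
      (layoutBody D f P).getD (f g' * bl (G := G) + (bl (G := G) + k - (D.children g').toList.length)) (.const 0) =
        mk (f g' * bl (G := G) + (bl (G := G) + k - (D.children g').toList.length) - 1) ((kidPos D f g').getD k 0))
    (h2 : 2 ≤ (D.children g).toList.length)
    (hπc : D.children (π g) = (D.children g).map π.toEmbedding) (hπl : D.label (π g) = D.label g)
    (hkids : ∀ c ∈ D.children g, gateLine D f P ρ π c ∈ L)
    {M : ℕ} (hM1 : 3 * (layoutBody D f P).length + 7 ≤ M)
    (hM2 : Fintype.card G * ((layoutBody D f P).length + 2) ≤ M) :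
    Real (pcSystem 𝔽 X) (gateLine D f P ρ π g :: L) (n + 60 * M * (Fintype.card G + 2) ^ 3) := by
  set B := layoutBody D f P with hB
  set Bρ := B.map (Node.rename ρ) with hBρ
  have hb : bl (G := G) = Fintype.card G + 2 := rfl
  have hlen : Bρ.length = B.length := length_map_rename ρ B
  have hrG : (D.children g).toList.length ≤ Fintype.card G := length_toList_children_le (D := D) g
  -- the two enumerations of children
  obtain ⟨c₀, ks', hks⟩ : ∃ c₀ ks', (D.children g).toList = c₀ :: ks' := by
    cases hq : (D.children g).toList with
    | nil => rw [hq] at h2; simp at h2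
    | cons c₀ ks' => exact ⟨c₀, ks', rfl⟩
  have hperm : (D.children (π g)).toList.Perm ((D.children g).toList.map π) := by
    have := toList_map_perm (D.children g) π.toEmbedding
    rw [← hπc] at this
    simpa using this
  have hrπ : (D.children (π g)).toList.length = (D.children g).toList.length := by
    rw [hperm.length_eq, List.length_map]
  obtain ⟨d₀, ds, hds⟩ : ∃ d₀ ds, (D.children (π g)).toList = d₀ :: ds := by
    cases hq : (D.children (π g)).toList with
    | nil => rw [hq, hks] at hrπ; simp at hrπ
    | cons d₀ ds => exact ⟨d₀, ds, rfl⟩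
  have hrk : (D.children g).toList.length = ks'.length + 1 := by rw [hks]; rfl
  have hrd : (D.children (π g)).toList.length = ds.length + 1 := by rw [hds]; rfl
  have hdk : ds.length = ks'.length := by have := hrπ; rw [hrk, hrd] at this; omega
  -- memberships
  have hmem_ks : ∀ c, c ∈ (D.children g).toList → c ∈ D.children g := fun c hc => Finset.mem_toList.1 hc
  have hc₀ : c₀ ∈ D.children g := hmem_ks c₀ (by rw [hks]; exact List.mem_cons_self)
  -- bounds
  have hM1' : B.length + 1 ≤ M := by omega
  have hM2r : (D.children g).toList.length * (B.length + 2) ≤ M := (Nat.mul_le_mul_right _ hrG).trans hM2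
  have hM2rπ : (D.children (π g)).toList.length * (B.length + 2) ≤ M := by rw [hrπ]; exact hM2r
  -- Step A on the renamed layout, gate `g`
  have hkp : ∀ k, k < (D.children g).toList.length → (kidPos D f g).getD k 0 < f g * bl (G := G) :=
    fun k hk => kidPos_getD_lt hmono g hk
  have A1 := Real.stepA (D := D) (f := f) Kt mk Bρ g (fun h' hn ha hb hM' => hun h' hn ha hb hM')
    (by rw [hBρ, getD_map_rename, hfirstL g rfl h2, hmk])
    (fun k hk hkr => by rw [hBρ, getD_map_rename, hsuccL g rfl k hk hkr, hmk])
    hkp h2 (M := M) (by rw [hlen]; exact hM1') (by rw [hlen]; exact hM2r) ks'.length (by omega) (by omega) h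
  have eA1 : (pre Bρ (f g * bl (G := G) + (bl (G := G) + ks'.length - (D.children g).toList.length)),
      comb Kt (pre Bρ ((kidPos D f g).getD 0 0)) ((((kidPos D f g).map (pre Bρ)).drop 1).take ks'.length)) =
      (pre Bρ (outPos f g), comb Kt (pre Bρ (outPos f c₀)) (ks'.map fun c => pre Bρ (outPos f c))) := by
    have e0 : f g * bl (G := G) + (bl (G := G) + ks'.length - (D.children g).toList.length) = outPos f g := by
      rw [outPos_eq_comb_last g (by omega : 1 ≤ (D.children g).toList.length) hrG, hrk, Nat.add_sub_cancel]
    rw [e0]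
    simp only [kidPos, hks, List.map_cons, List.getD_cons_zero, List.drop_succ_cons, List.drop_zero,
      List.map_map]
    rw [List.take_of_length_le (by simp)]
    rfl
  rw [eA1] at A1
  -- Step A on the layout, gate `π g`
  have hkpπ : ∀ k, k < (D.children (π g)).toList.length → (kidPos D f (π g)).getD k 0 < f (π g) * bl (G := G) :=
    fun k hk => kidPos_getD_lt hmono (π g) hk
  have h2π : 2 ≤ (D.children (π g)).toList.length := by rw [hrπ]; exact h2
  have hrGπ : (D.children (π g)).toList.length ≤ Fintype.card G := by rw [hrπ]; exact hrG
  have A2 := Real.stepA (D := D) (f := f) Kt mk B (π g) (fun h' hn ha hb hM' => hun h' hn ha hb hM')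
    (hfirstL (π g) hπl h2π) (fun k hk hkr => hsuccL (π g) hπl k hk hkr)
    hkpπ h2π (M := M) hM1' hM2rπ ds.length (by omega) (by omega) A1
  have eA2 : (pre B (f (π g) * bl (G := G) + (bl (G := G) + ds.length - (D.children (π g)).toList.length)),
      comb Kt (pre B ((kidPos D f (π g)).getD 0 0)) ((((kidPos D f (π g)).map (pre B)).drop 1).take ds.length)) =
      (pre B (outPos f (π g)), comb Kt (pre B (outPos f d₀)) (ds.map fun c => pre B (outPos f c))) := by
    have e0 : f (π g) * bl (G := G) + (bl (G := G) + ds.length - (D.children (π g)).toList.length) = outPos f (π g) := by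
      rw [outPos_eq_comb_last (π g) (by omega : 1 ≤ (D.children (π g)).toList.length) hrGπ, hrd, Nat.add_sub_cancel]
    rw [e0]
    simp only [kidPos, hds, List.map_cons, List.getD_cons_zero, List.drop_succ_cons, List.drop_zero,
      List.map_map]
    rw [List.take_of_length_le (by simp)]
    rfl
  rw [eA2] at A2
  -- weights of the combs in play
  have hW1 : W (pcSystem 𝔽 X) (pre Bρ (outPos f c₀)) (ks'.map fun c => pre Bρ (outPos f c)) ≤ M :=
    W_pre_le (s := Fintype.card G) _ ks' _ (by omega) (by rw [hlen]; exact hM2)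
  have hW2 : W (pcSystem 𝔽 X) (pre B (outPos f (π c₀))) (ks'.map fun c => pre B (outPos f (π c))) ≤ M :=
    W_pre_le (s := Fintype.card G) _ ks' _ (by omega) hM2
  have hW3 : W (pcSystem 𝔽 X) (pre B (outPos f d₀)) (ds.map fun c => pre B (outPos f c)) ≤ M :=
    W_pre_le (s := Fintype.card G) _ ds _ (by omega) hM2
  -- Step B: replace the children by their images (the children's gate lines)
  have B1 := A2.combCongrList Kt (ks'.map fun c => pre Bρ (outPos f c)) (ks'.map fun c => pre B (outPos f (π c)))
    (a := pre Bρ (outPos f c₀)) (a' := pre B (outPos f (π c₀)))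
    (List.mem_cons_of_mem _ (List.mem_cons_of_mem _ (hkids c₀ hc₀)))
    (by
      rw [List.forall₂_map_left_iff, List.forall₂_map_right_iff, List.forall₂_same]
      intro c hc
      exact List.mem_cons_of_mem _ (List.mem_cons_of_mem _
        (hkids c (hmem_ks c (by rw [hks]; exact List.mem_cons_of_mem _ hc)))))
    hW1 hW2
  -- Step C: sort the comb
  have hp : (pre B (outPos f (π c₀)) :: ks'.map fun c => pre B (outPos f (π c))).Perm
      (pre B (outPos f d₀) :: ds.map fun c => pre B (outPos f c)) := by
    have e1 : (pre B (outPos f (π c₀)) :: ks'.map fun c => pre B (outPos f (π c))) =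
        ((D.children g).toList.map π).map fun c => pre B (outPos f c) := by rw [hks]; simp
    have e2 : (pre B (outPos f d₀) :: ds.map fun c => pre B (outPos f c)) =
        (D.children (π g)).toList.map fun c => pre B (outPos f c) := by rw [hds]; simp
    rw [e1, e2]
    exact (hperm.map _).symm
  have C1 := B1.combPermHead Kt hp hW2
  -- symm of A2, then chain A1 · B1 · C1 · A2⁻¹
  have sz : ∀ i, (pcSystem 𝔽 X).size (pre B i) ≤ M ∧ (pcSystem 𝔽 X).size (pre Bρ i) ≤ M := fun i => by
    have := size_pre_le B i; have := size_pre_le Bρ i; simp only [pcSystem]; omega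
  have sc2 : (pcSystem 𝔽 X).size (comb Kt (pre B (outPos f (π c₀))) (ks'.map fun c => pre B (outPos f (π c)))) ≤ M := by
    rw [size_comb]; exact hW2
  have sc3 : (pcSystem 𝔽 X).size (comb Kt (pre B (outPos f d₀)) (ds.map fun c => pre B (outPos f c))) ≤ M := by
    rw [size_comb]; exact hW3
  have A3 := C1.symmB (List.mem_cons_of_mem _ (List.mem_cons_of_mem _ List.mem_cons_self)) (sz _).1 sc3
  have F := A3.trans₄
    (List.mem_cons_of_mem _ (List.mem_cons_of_mem _ (List.mem_cons_of_mem _ (List.mem_cons_of_mem _ List.mem_cons_self))))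
    (List.mem_cons_of_mem _ (List.mem_cons_of_mem _ List.mem_cons_self))
    (List.mem_cons_of_mem _ List.mem_cons_self) List.mem_cons_self (sz _).2 sc2 sc3 (sz _).1
  refine F.mono (List.cons_subset_cons _ fun e he => ?_) ?_
  · exact List.mem_cons_of_mem _ (List.mem_cons_of_mem _ (List.mem_cons_of_mem _
      (List.mem_cons_of_mem _ (List.mem_cons_of_mem _ he))))
  · simp only [List.length_map]
    have hk1 : ks'.length + 1 ≤ Fintype.card G := by rw [← hrk]; exact hrG
    have := arith_comb M (ks'.length + 1) (Fintype.card G) hk1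
    simp only [Nat.add_sub_cancel] at this
    rw [hdk] at *
    linarith

end PCR

open Literature.Computability.AlgebraicComplexity in
/-- **Enumerations of the image of a finite set under an embedding** (registered helper toward the
necessity of stub T′ `stub_invarianceProvableQP'`, crux `RestorationQP`; the combinatorial fact
behind the sorting step of the comb case): listing `π(S)` gives a permutation of `π` applied to the
listing of `S`. [folklore] -/
theorem invarianceProvableQP_aux_toListMapPerm : ∀ (G : Type) (S : Finset G) (π : Equiv.Perm G), (S.map π.toEmbedding).toList.Perm (S.toList.map π) := by
  intro G S π
  simpa using PCR.toList_map_perm S π.toEmbedding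

end Summit.ValiantsHypothesis.ValiantsHypothesis.Theorems

end
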